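import Summits.QuantumFields.YangMills.Theorems.PoincareLipschitzKuhnHat
import Mathlib.Analysis.Calculus.FDeriv.Add
import Mathlib.Analysis.Calculus.FDeriv.Linear
import Mathlib.Analysis.Calculus.FDeriv.Mul
import HarnessLib

/-!
# The Courant `P1` interpolant on the Freudenthal–Kuhn triangulation — the interpolant on a Kuhn simplex: collapse to the
# path vertices, the affine (Abel) form, nodal exactness, convexity, the distance row, and the DERIVATIVE with its energy
# density (K2 organ `hImproveCoreFlat`, ORGAN memo §4 brick B3, mesh-side half; LINE 25 `stub_latticeToContinuumLimit` (Γ1)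
# letters; cell ym3-torus, seat px7 g7)

Helper toward crux `stmt-QuantumFields-19936` (`Summit.QuantumFields.YangMills.Theses.UnitScaleTilt.HistoryTailL`).  Sibling of
`PoincareLipschitzKuhnHat` (the hat letters `φ`).  Letters: a finite set `S : Finset (Zd 3)` of lattice points carrying data
`u : Zd 3 → E`; the interpolant `I : EuclideanSpace ℝ (Fin 3) → E` with its defining equation as the hypothesis
`hI : ∀ x, I x = ∑ w ∈ S, φ (fun i => x i - w i) • u w` (DEF-FREE: consumers instantiate `I` and `φ` by `fun _ => rfl`); a cube
corner `y : Zd 3`, a permutation `σ : Equiv.Perm (Fin 3)`, and a point `x` of the closed Kuhn simplex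
`y (σ 2) ≤ x (σ 2)`, `x (σ 2) - y (σ 2) ≤ x (σ 1) - y (σ 1) ≤ x (σ 0) - y (σ 0)`, `x (σ 0) ≤ y (σ 0) + 1`, whose four path
vertices `y`, `y + e_{σ0}`, `y + e_{σ0} + e_{σ1}`, `y + e_{σ0} + e_{σ1} + e_{σ2}` (`e_μ = unitVec μ`) lie in `S`.

WHAT IS PROVED (all `theorem`s).  §3 ★`interp_eq_sum_vertices` (the lattice sum collapses to the four path vertices with the
barycentric weights), ★★`interp_eq_affine` (`I x = u y + ∑_{k<3} (x (σ k) - y (σ k)) • (u (p_k + e_{σ k}) - u p_k)` — the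
coefficient vectors ARE the organ's bond differences `u (p + unitVec μ) - u p` along the monotone lattice path), `interp_intCast`
(nodal exactness), `norm_interp_le_one` (convexity: unit data ⇒ `‖I x‖ ≤ 1`), ★`norm_interp_sub_le` (`‖I x - u y‖ ≤ ‖δ₀‖ + ‖δ₁‖ + ‖δ₂‖`
— the distance-to-the-data row the blow-down uses to put the limit on `S³`).  §4 `isOpen_openSimplex`, ★★`hasFDerivAt_interp` (on
the OPEN simplex `I` has the constant Fréchet derivative `L_σ = ∑_k proj (σ k) • δ_k`), `sum_normSq_deriv_single` and
★★`energyDensity_interp_eq`: in LINE 25's own letters, `∑ i, ‖fderiv ℝ I x (EuclideanSpace.single i 1)‖ ^ 2 = ‖δ₀‖² + ‖δ₁‖² + ‖δ₂‖²`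
— the energy density on the open Kuhn simplex IS the bond energy of its monotone lattice path.  The measure half (volume `1∕6`,
per-cube energy identity, box sums) is the sibling `PoincareLipschitzKuhnEnergy`.

HONEST: finite-dimensional algebra and one-line calculus; nothing of `stub_latticeToContinuumLimit`, `hImproveCoreFlat`, K1,
`MeanDeviationL`, `BlockLipschitzL`, `HistoryTailL` is proved; YM₃ on T³ is ladder rung R3 — not d = 4, not infinite volume,
not a mass gap, not Clay.
-/

open scoped BigOperators
open Literature.MathematicalPhysics.QuantumFieldTheory.Balaban1983to89 B4Eq19LatticeOperators

noncomputable section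

namespace Summit.QuantumFields.YangMills.Theorems.PoincareLipschitzKuhnInterpolant

open Summit.QuantumFields.YangMills.Theorems.PoincareLipschitzKuhnHat

variable {E : Type*} [NormedAddCommGroup E] [NormedSpace ℝ E]
variable (φ : (Fin 3 → ℝ) → ℝ)

/-! ## §3 The interpolant on a closed Kuhn simplex

Letters: `S : Finset (Zd 3)` a finite set of lattice points carrying the data, `I x = ∑_{w ∈ S} φ (x - w) • u w` the interpolant
(hypothesis `hI`), a cube corner `y : Zd 3` and a permutation `σ`; the point `x : EuclideanSpace ℝ (Fin 3)` lies in the closed Kuhn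
simplex `y + {1 ≥ t (σ 0) ≥ t (σ 1) ≥ t (σ 2) ≥ 0}`; the path vertices `y`, `y + e_{σ 0}`, `y + e_{σ 0} + e_{σ 1}`,
`y + e_{σ 0} + e_{σ 1} + e_{σ 2}` (`e_μ = unitVec μ`) belong to `S`. -/

/-- The indicator form of the path vertex `v_0` is `0`. -/
theorem pathVertex_zero (σ : Equiv.Perm (Fin 3)) :
    (fun i => if ((σ.symm i : Fin 3) : ℕ) < 0 then (1:ℤ) else 0) = 0 := by
  funext i; simp

/-- The indicator form of the path vertex `v_1` is `e_{σ 0}`. -/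
theorem pathVertex_one (σ : Equiv.Perm (Fin 3)) :
    (fun i => if ((σ.symm i : Fin 3) : ℕ) < 1 then (1:ℤ) else 0) = unitVec (σ 0) := by
  funext i
  obtain ⟨j, rfl⟩ : ∃ j, i = σ j := ⟨σ.symm i, by simp⟩
  simp only [Equiv.symm_apply_apply, unitVec, Pi.single_apply, σ.injective.eq_iff]
  fin_cases j <;> simp

/-- The indicator form of the path vertex `v_2` is `e_{σ 0} + e_{σ 1}`. -/
theorem pathVertex_two (σ : Equiv.Perm (Fin 3)) :
    (fun i => if ((σ.symm i : Fin 3) : ℕ) < 2 then (1:ℤ) else 0) = unitVec (σ 0) + unitVec (σ 1) := by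
  funext i
  obtain ⟨j, rfl⟩ : ∃ j, i = σ j := ⟨σ.symm i, by simp⟩
  simp only [Equiv.symm_apply_apply, unitVec, Pi.add_apply, Pi.single_apply, σ.injective.eq_iff]
  fin_cases j <;> simp

/-- The indicator form of the path vertex `v_3` is `e_{σ 0} + e_{σ 1} + e_{σ 2}` (`= 𝟙`). -/
theorem pathVertex_three (σ : Equiv.Perm (Fin 3)) :
    (fun i => if ((σ.symm i : Fin 3) : ℕ) < 3 then (1:ℤ) else 0) = unitVec (σ 0) + unitVec (σ 1) + unitVec (σ 2) := by
  funext i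
  obtain ⟨j, rfl⟩ : ∃ j, i = σ j := ⟨σ.symm i, by simp⟩
  simp only [Equiv.symm_apply_apply, unitVec, Pi.add_apply, Pi.single_apply, σ.injective.eq_iff]
  fin_cases j <;> simp

/-- ★ COLLAPSE TO THE PATH VERTICES: on the closed Kuhn simplex of `σ` at the cube corner `y`, the lattice sum defining `I x`
has exactly four (possibly) non-zero terms — the path vertices `y`, `y + e_{σ0}`, `y + e_{σ0} + e_{σ1}`, `y + e_{σ0} + e_{σ1} + e_{σ2}` —
weighted by the barycentric coordinates `1 - t (σ 0)`, `t (σ 0) - t (σ 1)`, `t (σ 1) - t (σ 2)`, `t (σ 2)` (`t = x - y`). -/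
theorem interp_eq_sum_vertices
    (hφ : ∀ t, φ t = max 0 (1 + min 0 (min (t 0) (min (t 1) (t 2))) - max 0 (max (t 0) (max (t 1) (t 2)))))
    (S : Finset (Zd 3)) (u : Zd 3 → E) (I : EuclideanSpace ℝ (Fin 3) → E)
    (hI : ∀ x, I x = ∑ w ∈ S, φ (fun i => x i - (w i : ℝ)) • u w)
    (y : Zd 3) (σ : Equiv.Perm (Fin 3)) (hS0 : y ∈ S) (hS1 : y + unitVec (σ 0) ∈ S)
    (hS2 : y + unitVec (σ 0) + unitVec (σ 1) ∈ S) (hS3 : y + unitVec (σ 0) + unitVec (σ 1) + unitVec (σ 2) ∈ S)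
    {x : EuclideanSpace ℝ (Fin 3)}
    (h0 : (y (σ 2) : ℝ) ≤ x (σ 2)) (h1 : x (σ 2) - y (σ 2) ≤ x (σ 1) - y (σ 1))
    (h2 : x (σ 1) - y (σ 1) ≤ x (σ 0) - y (σ 0)) (h3 : x (σ 0) ≤ y (σ 0) + 1) :
    I x = (1 - (x (σ 0) - y (σ 0))) • u y + ((x (σ 0) - y (σ 0)) - (x (σ 1) - y (σ 1))) • u (y + unitVec (σ 0))
      + ((x (σ 1) - y (σ 1)) - (x (σ 2) - y (σ 2))) • u (y + unitVec (σ 0) + unitVec (σ 1))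
      + (x (σ 2) - y (σ 2)) • u (y + unitVec (σ 0) + unitVec (σ 1) + unitVec (σ 2)) := by
  -- relative coordinates
  set t : Fin 3 → ℝ := fun i => x i - (y i : ℝ) with ht
  have h0' : 0 ≤ t (σ 2) := by simp only [ht]; linarith
  have h1' : t (σ 2) ≤ t (σ 1) := by simpa [ht] using h1
  have h2' : t (σ 1) ≤ t (σ 0) := by simpa [ht] using h2
  have h3' : t (σ 0) ≤ 1 := by simp only [ht]; linarith
  rw [hI]
  -- the vertex map in indicator form, injective on `range 4`
  set V : ℕ → Zd 3 := fun k => y + fun i => if ((σ.symm i : Fin 3) : ℕ) < k then 1 else 0 with hV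
  have hVinj : Set.InjOn V ↑(Finset.range 4) := by
    intro k hk k' hk' h
    simp only [Finset.coe_range, Set.mem_Iio] at hk hk'
    have hcnt : ∀ m < 4, (∑ j : Fin 3, (V m - y) (σ j)) = m := by
      intro m hm
      simp only [hV, add_sub_cancel_left, Equiv.symm_apply_apply, Fin.sum_univ_three, Fin.val_zero, Fin.val_one,
        Fin.val_two]
      interval_cases m <;> simp
    have := hcnt k hk
    rw [h, hcnt k' hk'] at this
    exact_mod_cast this.symm
  have hV0 : V 0 = y := by simp only [hV, pathVertex_zero, add_zero]
  have hV1 : V 1 = y + unitVec (σ 0) := by simp only [hV, pathVertex_one]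
  have hV2 : V 2 = y + unitVec (σ 0) + unitVec (σ 1) := by simp only [hV, pathVertex_two, add_assoc]
  have hV3 : V 3 = y + unitVec (σ 0) + unitVec (σ 1) + unitVec (σ 2) := by
    simp only [hV, pathVertex_three, add_assoc]
  -- restrict the sum to the image of `V`
  have himg : (Finset.range 4).image V ⊆ S := by
    intro w hw
    obtain ⟨k, hk, rfl⟩ := Finset.mem_image.mp hw
    have hk : k < 4 := Finset.mem_range.mp hk
    interval_cases k
    · rwa [hV0]
    · rwa [hV1]
    · rwa [hV2]
    · rwa [hV3]
  rw [← Finset.sum_subset himg]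
  · rw [Finset.sum_image hVinj]
    have hterm : ∀ k ∈ Finset.range 4, φ (fun i => x i - ((V k) i : ℝ)) • u (V k) =
        (if k = 0 then 1 - t (σ 0) else if k = 1 then t (σ 0) - t (σ 1) else if k = 2 then t (σ 1) - t (σ 2)
          else t (σ 2)) • u (V k) := by
      intro k hk
      have hk3 : k ≤ 3 := by simpa [Nat.lt_succ_iff] using Finset.mem_range.mp hk
      have harg : (fun i => x i - ((V k) i : ℝ)) = fun i => t i - if ((σ.symm i : Fin 3) : ℕ) < k then 1 else 0 := by
        funext i; simp only [hV, ht, Pi.add_apply]; push_cast; split_ifs <;> ring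
      rw [harg, hat_sub_vertex φ hφ σ h0' h1' h2' h3' k hk3]
    rw [Finset.sum_congr rfl hterm]
    simp only [Finset.sum_range_succ, Finset.sum_range_zero, zero_add, hV0, hV1, hV2, hV3,
      show (1:ℕ) = 0 ↔ False by decide, show (2:ℕ) = 0 ↔ False by decide, show (2:ℕ) = 1 ↔ False by decide,
      show (3:ℕ) = 0 ↔ False by decide, show (3:ℕ) = 1 ↔ False by decide, show (3:ℕ) = 2 ↔ False by decide,
      reduceIte, ht]
  · intro w hwS hwV
    have hw : ∀ k ≤ 3, w - y ≠ fun i => if ((σ.symm i : Fin 3) : ℕ) < k then 1 else 0 := by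
      intro k hk h
      apply hwV
      refine Finset.mem_image.mpr ⟨k, Finset.mem_range.mpr (by omega), ?_⟩
      simp only [hV]; rw [← h]; abel
    have harg : (fun i => x i - (w i : ℝ)) = fun i => t i - (((w - y) i : ℤ) : ℝ) := by
      funext i; simp only [ht, Pi.sub_apply]; push_cast; ring
    rw [harg, hat_sub_int_eq_zero φ hφ σ h0' h1' h2' h3' (w - y) hw, zero_smul]

/-- ★★ THE AFFINE (ABEL) FORM: on the closed Kuhn simplex of `σ` at `y`,
`I x = u y + ∑_{k<3} t (σ k) • (u (p_k + e_{σ k}) - u p_k)`, `p_0 = y`, `p_{k+1} = p_k + e_{σ k}` — the three coefficient vectors ARE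
the organ's bond differences `u (p + unitVec μ) - u p` along the monotone lattice path. -/
theorem interp_eq_affine
    (hφ : ∀ t, φ t = max 0 (1 + min 0 (min (t 0) (min (t 1) (t 2))) - max 0 (max (t 0) (max (t 1) (t 2)))))
    (S : Finset (Zd 3)) (u : Zd 3 → E) (I : EuclideanSpace ℝ (Fin 3) → E)
    (hI : ∀ x, I x = ∑ w ∈ S, φ (fun i => x i - (w i : ℝ)) • u w)
    (y : Zd 3) (σ : Equiv.Perm (Fin 3)) (hS0 : y ∈ S) (hS1 : y + unitVec (σ 0) ∈ S)
    (hS2 : y + unitVec (σ 0) + unitVec (σ 1) ∈ S) (hS3 : y + unitVec (σ 0) + unitVec (σ 1) + unitVec (σ 2) ∈ S)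
    {x : EuclideanSpace ℝ (Fin 3)}
    (h0 : (y (σ 2) : ℝ) ≤ x (σ 2)) (h1 : x (σ 2) - y (σ 2) ≤ x (σ 1) - y (σ 1))
    (h2 : x (σ 1) - y (σ 1) ≤ x (σ 0) - y (σ 0)) (h3 : x (σ 0) ≤ y (σ 0) + 1) :
    I x = u y + (x (σ 0) - y (σ 0)) • (u (y + unitVec (σ 0)) - u y)
      + (x (σ 1) - y (σ 1)) • (u (y + unitVec (σ 0) + unitVec (σ 1)) - u (y + unitVec (σ 0)))
      + (x (σ 2) - y (σ 2)) •
          (u (y + unitVec (σ 0) + unitVec (σ 1) + unitVec (σ 2)) - u (y + unitVec (σ 0) + unitVec (σ 1))) := by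
  rw [interp_eq_sum_vertices φ hφ S u I hI y σ hS0 hS1 hS2 hS3 h0 h1 h2 h3]
  simp only [sub_smul, smul_sub, one_smul]
  abel

/-- VERTEX EXACTNESS: the interpolant reproduces the data at every lattice point of `S` (nodal basis). -/
theorem interp_intCast
    (hφ : ∀ t, φ t = max 0 (1 + min 0 (min (t 0) (min (t 1) (t 2))) - max 0 (max (t 0) (max (t 1) (t 2)))))
    (S : Finset (Zd 3)) (u : Zd 3 → E) (I : EuclideanSpace ℝ (Fin 3) → E)
    (hI : ∀ x, I x = ∑ w ∈ S, φ (fun i => x i - (w i : ℝ)) • u w) {y : Zd 3} (hy : y ∈ S)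
    (x : EuclideanSpace ℝ (Fin 3)) (hx : ∀ i, x i = y i) : I x = u y := by
  rw [hI]
  have hterm : ∀ w ∈ S, φ (fun i => x i - (w i : ℝ)) • u w = if w = y then u y else 0 := by
    intro w hw
    have harg : (fun i => x i - (w i : ℝ)) = fun i => (((y - w) i : ℤ) : ℝ) := by
      funext i; rw [hx i]; push_cast [Pi.sub_apply]; ring
    rw [harg, hat_intCast φ hφ (y - w)]
    by_cases hwy : w = y
    · subst hwy; simp
    · have : y - w ≠ 0 := fun h => hwy (eq_of_sub_eq_zero h).symm
      simp [this, hwy]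
  rw [Finset.sum_congr rfl hterm, Finset.sum_ite_eq' S y, if_pos hy]

/-- CONVEXITY: on the closed simplex, `‖I x‖` is at most the largest `‖u‖` at the four path vertices; in particular
`‖I x‖ ≤ 1` for unit data. -/
theorem norm_interp_le_one
    (hφ : ∀ t, φ t = max 0 (1 + min 0 (min (t 0) (min (t 1) (t 2))) - max 0 (max (t 0) (max (t 1) (t 2)))))
    (S : Finset (Zd 3)) (u : Zd 3 → E) (I : EuclideanSpace ℝ (Fin 3) → E)
    (hI : ∀ x, I x = ∑ w ∈ S, φ (fun i => x i - (w i : ℝ)) • u w)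
    (hu : ∀ w, ‖u w‖ ≤ 1)
    (y : Zd 3) (σ : Equiv.Perm (Fin 3)) (hS0 : y ∈ S) (hS1 : y + unitVec (σ 0) ∈ S)
    (hS2 : y + unitVec (σ 0) + unitVec (σ 1) ∈ S) (hS3 : y + unitVec (σ 0) + unitVec (σ 1) + unitVec (σ 2) ∈ S)
    {x : EuclideanSpace ℝ (Fin 3)}
    (h0 : (y (σ 2) : ℝ) ≤ x (σ 2)) (h1 : x (σ 2) - y (σ 2) ≤ x (σ 1) - y (σ 1))
    (h2 : x (σ 1) - y (σ 1) ≤ x (σ 0) - y (σ 0)) (h3 : x (σ 0) ≤ y (σ 0) + 1) :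
    ‖I x‖ ≤ 1 := by
  rw [interp_eq_sum_vertices φ hφ S u I hI y σ hS0 hS1 hS2 hS3 h0 h1 h2 h3]
  have ha : 0 ≤ 1 - (x (σ 0) - y (σ 0)) := by linarith
  have hb : 0 ≤ (x (σ 0) - y (σ 0)) - (x (σ 1) - y (σ 1)) := by linarith
  have hc : 0 ≤ (x (σ 1) - y (σ 1)) - (x (σ 2) - y (σ 2)) := by linarith
  have hd : 0 ≤ x (σ 2) - y (σ 2) := by linarith
  calc _ ≤ ‖(1 - (x (σ 0) - y (σ 0))) • u y + ((x (σ 0) - y (σ 0)) - (x (σ 1) - y (σ 1))) • u (y + unitVec (σ 0))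
        + ((x (σ 1) - y (σ 1)) - (x (σ 2) - y (σ 2))) • u (y + unitVec (σ 0) + unitVec (σ 1))‖
        + ‖(x (σ 2) - y (σ 2)) • u (y + unitVec (σ 0) + unitVec (σ 1) + unitVec (σ 2))‖ := norm_add_le _ _
    _ ≤ ‖(1 - (x (σ 0) - y (σ 0))) • u y + ((x (σ 0) - y (σ 0)) - (x (σ 1) - y (σ 1))) • u (y + unitVec (σ 0))‖
        + ‖((x (σ 1) - y (σ 1)) - (x (σ 2) - y (σ 2))) • u (y + unitVec (σ 0) + unitVec (σ 1))‖
        + ‖(x (σ 2) - y (σ 2)) • u (y + unitVec (σ 0) + unitVec (σ 1) + unitVec (σ 2))‖ := by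
          gcongr; exact norm_add_le _ _
    _ ≤ ‖(1 - (x (σ 0) - y (σ 0))) • u y‖ + ‖((x (σ 0) - y (σ 0)) - (x (σ 1) - y (σ 1))) • u (y + unitVec (σ 0))‖
        + ‖((x (σ 1) - y (σ 1)) - (x (σ 2) - y (σ 2))) • u (y + unitVec (σ 0) + unitVec (σ 1))‖
        + ‖(x (σ 2) - y (σ 2)) • u (y + unitVec (σ 0) + unitVec (σ 1) + unitVec (σ 2))‖ := by
          gcongr; exact norm_add_le _ _
    _ ≤ (1 - (x (σ 0) - y (σ 0))) * 1 + ((x (σ 0) - y (σ 0)) - (x (σ 1) - y (σ 1))) * 1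
        + ((x (σ 1) - y (σ 1)) - (x (σ 2) - y (σ 2))) * 1 + (x (σ 2) - y (σ 2)) * 1 := by
          rw [norm_smul, norm_smul, norm_smul, norm_smul, Real.norm_of_nonneg ha, Real.norm_of_nonneg hb,
            Real.norm_of_nonneg hc, Real.norm_of_nonneg hd]
          gcongr <;> exact hu _
    _ = 1 := by ring

/-- ★ THE DISTANCE ROW (what the blow-down needs to put the limit on the sphere): on the closed simplex,
`‖I x - u y‖ ≤ ‖δ₀‖ + ‖δ₁‖ + ‖δ₂‖`, the three bond differences of the path — hence `≤ √3 · (path energy)^{1/2}`. -/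
theorem norm_interp_sub_le
    (hφ : ∀ t, φ t = max 0 (1 + min 0 (min (t 0) (min (t 1) (t 2))) - max 0 (max (t 0) (max (t 1) (t 2)))))
    (S : Finset (Zd 3)) (u : Zd 3 → E) (I : EuclideanSpace ℝ (Fin 3) → E)
    (hI : ∀ x, I x = ∑ w ∈ S, φ (fun i => x i - (w i : ℝ)) • u w)
    (y : Zd 3) (σ : Equiv.Perm (Fin 3)) (hS0 : y ∈ S) (hS1 : y + unitVec (σ 0) ∈ S)
    (hS2 : y + unitVec (σ 0) + unitVec (σ 1) ∈ S) (hS3 : y + unitVec (σ 0) + unitVec (σ 1) + unitVec (σ 2) ∈ S)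
    {x : EuclideanSpace ℝ (Fin 3)}
    (h0 : (y (σ 2) : ℝ) ≤ x (σ 2)) (h1 : x (σ 2) - y (σ 2) ≤ x (σ 1) - y (σ 1))
    (h2 : x (σ 1) - y (σ 1) ≤ x (σ 0) - y (σ 0)) (h3 : x (σ 0) ≤ y (σ 0) + 1) :
    ‖I x - u y‖ ≤ ‖u (y + unitVec (σ 0)) - u y‖ + ‖u (y + unitVec (σ 0) + unitVec (σ 1)) - u (y + unitVec (σ 0))‖
      + ‖u (y + unitVec (σ 0) + unitVec (σ 1) + unitVec (σ 2)) - u (y + unitVec (σ 0) + unitVec (σ 1))‖ := by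
  rw [interp_eq_affine φ hφ S u I hI y σ hS0 hS1 hS2 hS3 h0 h1 h2 h3]
  have ha : 0 ≤ x (σ 0) - y (σ 0) := by linarith
  have hb : 0 ≤ x (σ 1) - y (σ 1) := by linarith
  have hc : 0 ≤ x (σ 2) - y (σ 2) := by linarith
  have ha1 : x (σ 0) - y (σ 0) ≤ 1 := by linarith
  have hb1 : x (σ 1) - y (σ 1) ≤ 1 := by linarith
  have hc1 : x (σ 2) - y (σ 2) ≤ 1 := by linarith
  rw [show u y + (x (σ 0) - ↑(y (σ 0))) • (u (y + unitVec (σ 0)) - u y)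
      + (x (σ 1) - ↑(y (σ 1))) • (u (y + unitVec (σ 0) + unitVec (σ 1)) - u (y + unitVec (σ 0)))
      + (x (σ 2) - ↑(y (σ 2))) • (u (y + unitVec (σ 0) + unitVec (σ 1) + unitVec (σ 2)) - u (y + unitVec (σ 0) + unitVec (σ 1)))
      - u y = (x (σ 0) - ↑(y (σ 0))) • (u (y + unitVec (σ 0)) - u y)
      + (x (σ 1) - ↑(y (σ 1))) • (u (y + unitVec (σ 0) + unitVec (σ 1)) - u (y + unitVec (σ 0)))
      + (x (σ 2) - ↑(y (σ 2))) • (u (y + unitVec (σ 0) + unitVec (σ 1) + unitVec (σ 2)) - u (y + unitVec (σ 0) + unitVec (σ 1)))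
      by abel]
  refine (norm_add_le _ _).trans (add_le_add ((norm_add_le _ _).trans (add_le_add ?_ ?_)) ?_)
  · rw [norm_smul, Real.norm_of_nonneg ha]; exact mul_le_of_le_one_left (norm_nonneg _) ha1
  · rw [norm_smul, Real.norm_of_nonneg hb]; exact mul_le_of_le_one_left (norm_nonneg _) hb1
  · rw [norm_smul, Real.norm_of_nonneg hc]; exact mul_le_of_le_one_left (norm_nonneg _) hc1

end Summit.QuantumFields.YangMills.Theorems.PoincareLipschitzKuhnInterpolant

namespace Summit.QuantumFields.YangMills.Theorems.PoincareLipschitzKuhnInterpolant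

open scoped Topology
open Summit.QuantumFields.YangMills.Theorems.PoincareLipschitzKuhnHat

variable {E : Type*} [NormedAddCommGroup E] [NormedSpace ℝ E]
variable (φ : (Fin 3 → ℝ) → ℝ)

/-! ## §4 The derivative on the OPEN Kuhn simplex and its energy density -/

/-- The open Kuhn simplex of `σ` at `y` (strict inequalities) is an open subset of `EuclideanSpace ℝ (Fin 3)`. -/
theorem isOpen_openSimplex (y : Zd 3) (σ : Equiv.Perm (Fin 3)) :
    IsOpen {x : EuclideanSpace ℝ (Fin 3) | (y (σ 2) : ℝ) < x (σ 2) ∧ x (σ 2) - y (σ 2) < x (σ 1) - y (σ 1) ∧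
      x (σ 1) - y (σ 1) < x (σ 0) - y (σ 0) ∧ x (σ 0) < y (σ 0) + 1} := by
  have hc : ∀ i : Fin 3, Continuous fun x : EuclideanSpace ℝ (Fin 3) => x i := fun i =>
    (EuclideanSpace.proj i).continuous
  refine (isOpen_lt continuous_const (hc (σ 2))).and ((isOpen_lt ((hc (σ 2)).sub continuous_const)
    ((hc (σ 1)).sub continuous_const)).and ((isOpen_lt ((hc (σ 1)).sub continuous_const)
    ((hc (σ 0)).sub continuous_const)).and (isOpen_lt (hc (σ 0)) continuous_const)))

/-- ★★ On the OPEN Kuhn simplex of `σ` at `y`, the interpolant is Fréchet differentiable with the CONSTANT derivative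
`L_σ = ∑_{k<3} (proj (σ k)) • δ_k`, `δ_k = u (p_k + e_{σ k}) - u p_k` the bond differences of the monotone path. -/
theorem hasFDerivAt_interp
    (hφ : ∀ t, φ t = max 0 (1 + min 0 (min (t 0) (min (t 1) (t 2))) - max 0 (max (t 0) (max (t 1) (t 2)))))
    (S : Finset (Zd 3)) (u : Zd 3 → E) (I : EuclideanSpace ℝ (Fin 3) → E)
    (hI : ∀ x, I x = ∑ w ∈ S, φ (fun i => x i - (w i : ℝ)) • u w)
    (y : Zd 3) (σ : Equiv.Perm (Fin 3)) (hS0 : y ∈ S) (hS1 : y + unitVec (σ 0) ∈ S)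
    (hS2 : y + unitVec (σ 0) + unitVec (σ 1) ∈ S) (hS3 : y + unitVec (σ 0) + unitVec (σ 1) + unitVec (σ 2) ∈ S)
    {x : EuclideanSpace ℝ (Fin 3)}
    (h0 : (y (σ 2) : ℝ) < x (σ 2)) (h1 : x (σ 2) - y (σ 2) < x (σ 1) - y (σ 1))
    (h2 : x (σ 1) - y (σ 1) < x (σ 0) - y (σ 0)) (h3 : x (σ 0) < y (σ 0) + 1) :
    HasFDerivAt I
      ((EuclideanSpace.proj (σ 0) : EuclideanSpace ℝ (Fin 3) →L[ℝ] ℝ).smulRight (u (y + unitVec (σ 0)) - u y)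
        + (EuclideanSpace.proj (σ 1) : EuclideanSpace ℝ (Fin 3) →L[ℝ] ℝ).smulRight (u (y + unitVec (σ 0) + unitVec (σ 1)) - u (y + unitVec (σ 0)))
        + (EuclideanSpace.proj (σ 2) : EuclideanSpace ℝ (Fin 3) →L[ℝ] ℝ).smulRight
            (u (y + unitVec (σ 0) + unitVec (σ 1) + unitVec (σ 2)) - u (y + unitVec (σ 0) + unitVec (σ 1)))) x := by
  -- the affine model `z ↦ c + L z`
  set δ0 := u (y + unitVec (σ 0)) - u y with hδ0
  set δ1 := u (y + unitVec (σ 0) + unitVec (σ 1)) - u (y + unitVec (σ 0)) with hδ1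
  set δ2 := u (y + unitVec (σ 0) + unitVec (σ 1) + unitVec (σ 2)) - u (y + unitVec (σ 0) + unitVec (σ 1)) with hδ2
  set L : EuclideanSpace ℝ (Fin 3) →L[ℝ] E :=
    (EuclideanSpace.proj (σ 0) : EuclideanSpace ℝ (Fin 3) →L[ℝ] ℝ).smulRight δ0
      + (EuclideanSpace.proj (σ 1) : EuclideanSpace ℝ (Fin 3) →L[ℝ] ℝ).smulRight δ1
      + (EuclideanSpace.proj (σ 2) : EuclideanSpace ℝ (Fin 3) →L[ℝ] ℝ).smulRight δ2 with hL
  have hLz : ∀ z : EuclideanSpace ℝ (Fin 3), L z = z (σ 0) • δ0 + z (σ 1) • δ1 + z (σ 2) • δ2 := fun z => by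
    simp [hL, ContinuousLinearMap.smulRight_apply]
  set c : E := u y - (y (σ 0) : ℝ) • δ0 - (y (σ 1) : ℝ) • δ1 - (y (σ 2) : ℝ) • δ2 with hc
  have hA : HasFDerivAt (fun z : EuclideanSpace ℝ (Fin 3) => c + L z) L x := (L.hasFDerivAt).const_add c
  refine hA.congr_of_eventuallyEq (Filter.eventuallyEq_of_mem ((isOpen_openSimplex y σ).mem_nhds ⟨h0, h1, h2, h3⟩) ?_)
  intro z hz
  obtain ⟨hz0, hz1, hz2, hz3⟩ := hz
  show I z = c + L z
  rw [interp_eq_affine φ hφ S u I hI y σ hS0 hS1 hS2 hS3 hz0.le hz1.le hz2.le hz3.le, hLz, hc]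
  simp only [sub_smul, hδ0, hδ1, hδ2]
  abel

/-- The columns of `L_σ`: `L_σ e_{σ k} = δ_k` — summed in squares over the three coordinate directions, the ENERGY DENSITY of
the interpolant on the open simplex is the PATH ENERGY `‖δ₀‖² + ‖δ₁‖² + ‖δ₂‖²`. -/
theorem sum_normSq_deriv_single (σ : Equiv.Perm (Fin 3)) (δ0 δ1 δ2 : E) :
    ∑ i : Fin 3, ‖((EuclideanSpace.proj (σ 0) : EuclideanSpace ℝ (Fin 3) →L[ℝ] ℝ).smulRight δ0 + (EuclideanSpace.proj (σ 1) : EuclideanSpace ℝ (Fin 3) →L[ℝ] ℝ).smulRight δ1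
        + (EuclideanSpace.proj (σ 2) : EuclideanSpace ℝ (Fin 3) →L[ℝ] ℝ).smulRight δ2 : EuclideanSpace ℝ (Fin 3) →L[ℝ] E)
        (EuclideanSpace.single i (1:ℝ))‖ ^ 2 = ‖δ0‖ ^ 2 + ‖δ1‖ ^ 2 + ‖δ2‖ ^ 2 := by
  rw [← Equiv.sum_comp σ (fun i : Fin 3 => ‖((EuclideanSpace.proj (σ 0) : EuclideanSpace ℝ (Fin 3) →L[ℝ] ℝ).smulRight δ0
      + (EuclideanSpace.proj (σ 1) : EuclideanSpace ℝ (Fin 3) →L[ℝ] ℝ).smulRight δ1 + (EuclideanSpace.proj (σ 2) : EuclideanSpace ℝ (Fin 3) →L[ℝ] ℝ).smulRight δ2 :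
        EuclideanSpace ℝ (Fin 3) →L[ℝ] E) (EuclideanSpace.single i (1:ℝ))‖ ^ 2)]
  simp [ContinuousLinearMap.smulRight_apply, PiLp.single_apply, σ.injective.eq_iff, Fin.sum_univ_three]

/-- ★★ THE ENERGY DENSITY ON THE OPEN SIMPLEX, in the blow-down's own letters
(`∑ i, ‖fderiv ℝ I x (EuclideanSpace.single i 1)‖ ^ 2`): it is the constant `‖δ₀‖² + ‖δ₁‖² + ‖δ₂‖²`, the bond energy of the
monotone lattice path `y → y + e_{σ0} → y + e_{σ0} + e_{σ1} → y + 𝟙`. -/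
theorem energyDensity_interp_eq
    (hφ : ∀ t, φ t = max 0 (1 + min 0 (min (t 0) (min (t 1) (t 2))) - max 0 (max (t 0) (max (t 1) (t 2)))))
    (S : Finset (Zd 3)) (u : Zd 3 → E) (I : EuclideanSpace ℝ (Fin 3) → E)
    (hI : ∀ x, I x = ∑ w ∈ S, φ (fun i => x i - (w i : ℝ)) • u w)
    (y : Zd 3) (σ : Equiv.Perm (Fin 3)) (hS0 : y ∈ S) (hS1 : y + unitVec (σ 0) ∈ S)
    (hS2 : y + unitVec (σ 0) + unitVec (σ 1) ∈ S) (hS3 : y + unitVec (σ 0) + unitVec (σ 1) + unitVec (σ 2) ∈ S)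
    {x : EuclideanSpace ℝ (Fin 3)}
    (h0 : (y (σ 2) : ℝ) < x (σ 2)) (h1 : x (σ 2) - y (σ 2) < x (σ 1) - y (σ 1))
    (h2 : x (σ 1) - y (σ 1) < x (σ 0) - y (σ 0)) (h3 : x (σ 0) < y (σ 0) + 1) :
    ∑ i : Fin 3, ‖fderiv ℝ I x (EuclideanSpace.single i (1:ℝ))‖ ^ 2 =
      ‖u (y + unitVec (σ 0)) - u y‖ ^ 2 + ‖u (y + unitVec (σ 0) + unitVec (σ 1)) - u (y + unitVec (σ 0))‖ ^ 2
      + ‖u (y + unitVec (σ 0) + unitVec (σ 1) + unitVec (σ 2)) - u (y + unitVec (σ 0) + unitVec (σ 1))‖ ^ 2 := by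
  rw [(hasFDerivAt_interp φ hφ S u I hI y σ hS0 hS1 hS2 hS3 h0 h1 h2 h3).fderiv]
  exact sum_normSq_deriv_single σ _ _ _

end Summit.QuantumFields.YangMills.Theorems.PoincareLipschitzKuhnInterpolant
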